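/-
Copyright (c) 2026 the pub-hodgecm-mathlib formalisation cell (harness21).  Prover seat hodgecm-mathlib-LH4-p08 (g7), req620 Track A «(D-RAM) FOUR-FRAME» squad, helper lane
on h413 = stmt-HodgeConjecture-24833 (count-neutral).  STAGE-1b typed inventory: THE ROW-(3) NUMBER OF `coefAffine(cA, cB)` IS `cA∕2`.  2026-09-04.
-/
import Summits.HodgeConjecture.HodgeConjecture.Theorems.F0P3cDyRamRowThreeReduction     -- ★ `measureReal_support_hFamily_ne_zero` (ν_s ≠ 0); brings ★ `hFamily`
import HarnessLib

/-!
# Crux `H413`, line LH4 «(D-RAM) FOUR-FRAME» — THE ROW-(3) NUMBER OF THE AFFINE COEFFICIENT VECTOR: `coefAffine(cA,cB) 0·ν_0 + coefAffine(cA,cB) 1·ν_1 = cA∕2`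

Cell `hodgecm-mathlib` (D-0151), FLOOR 0, crux item H413 = `stmt-HodgeConjecture-24833`, route of record `HCCMUnconditional`; squad F0∕P3c∕LH4 (req618∕req620); helper lane
`--supports stmt-HodgeConjecture-24833 --as helper` (count-neutral).  THEOREMS ONLY (no `def`, no instance, no notation, no `sorry`; default heartbeats).

WHAT.  The (H-·) sheets solve the per-place rows for `ψ := hFamily` with the coefficient vector of ★ p859018 ∕ ★ `hSideIdentity_hFamily_coefAffine_of_affine_token`,
`coefAffine(cA, cB) := fun s ↦ if s ≡ d (mod 2) then (cA + cB)∕(2ν_s) else −cB∕(2ν_s)`, `ν_s := νH.real (supp hFamily s)`.  The row-(3) letters (★ (V5-lev)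
`rowThree_levels_hFamily_of_scalar`, ★ p859539 `rowThree_piece…_hFamily_of_scalar`) read ONLY the number `coef 0·ν_0 + coef 1·ν_1`; for `coefAffine` that number is `cA∕2`
whatever the parity of `d` and whatever `cB` (two-germ rigidity: the Levi row sees only the `V(N)`-slope of row (1)).  `ν_s ≠ 0` is ★ `measureReal_support_hFamily_ne_zero`.
So a producer of LH4-p06 (g6)'s per-place letter `∃ cA cB N₁, hA ∧ hG₂ ∧ hnum` discharges `hnum` by `rw [coefAffine_rowThree_number_eq]` at `cA := 2ρ·(νG₃(K)∕νH(K_H))·ν_0`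
(`coefAffine_rowThree_number_eq_of_eq`), leaving `cB` to rows (1)(2).

* `coefAffine_rowThree_number_eq` — the number is `cA ∕ 2`.
* `coefAffine_rowThree_number_eq_of_eq` — if `cA = 2·R` the number is `R` (the `hnum` shape, `R := ρ·((νG₃.real K : ℂ)∕(νH.real K_H : ℂ)·ν_0)`).
HONEST LABEL.  Count-neutral (`--supports`): arithmetic over ★ only; pays no registered stub and touches no `Lines/` module; the three tier-0 rows stay OPEN; `HC_CM` is proved
only modulo the 7 printed citations (2 remaining named inputs: hLiu418 = `stmt-HodgeConjecture-24832`, h413 = `stmt-HodgeConjecture-24833`) until rung 0 closes.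

## References
* [Rogawski1990] J. D. Rogawski, *Automorphic Representations of Unitary Groups in Three Variables*, Ann. of Math. Stud. 123 (1990): §4.9 Lemma 4.9.2 p. 56; §3.5
  Prop. 3.5.2 pp. 25–26.
* [Kottwitz1986BaseChangeUnits] R. E. Kottwitz, *Base change for unit elements of Hecke algebras*, Compositio Math. 60 (1986), §1 pp. 240–241.
-/

set_option autoImplicit false

noncomputable section

namespace Summit.HodgeConjecture.HodgeConjecture.Cruxes.H413.F0P3cDyRamCoefAffineRowThreeNumber

open MeasureTheory Measure NumberField IsDedekindDomain Topology Filter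
open Literature.NumberTheory.Automorphic Literature.NumberTheory.Automorphic.UnitaryGroup Literature.NumberTheory.Automorphic.IntegralReduction
open Literature.NumberTheory.Automorphic.UnitaryLatticeTree Literature.NumberTheory.Automorphic.HermitianLattice
open Literature.NumberTheory.Rogawski1990 Literature.NumberTheory.GaloisRepresentations
open scoped Matrix MatrixGroups Classical ValuativeRel WithZero
open Summit.HodgeConjecture.HodgeConjecture.Cruxes.H413.F0P3cDyRamFourFrameHFamilyDefs
open Summit.HodgeConjecture.HodgeConjecture.Cruxes.H413.F0P3cDyRamRowThreeReduction

/-- **The row-(3) number of `coefAffine(cA, cB)` is `cA∕2`**: `coefAffine 0·ν_0 + coefAffine 1·ν_1 = cA∕2` for every parity of `d` and every `cB` (`ν_s ≠ 0`, ★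
`measureReal_support_hFamily_ne_zero`; `field_simp; ring` in each parity).  [cite: Rogawski1990, §4.9 Lemma 4.9.2 p. 56; §3.5 Prop. 3.5.2 pp. 25–26] -/
theorem coefAffine_rowThree_number_eq
    (L : Type) [Field L] [NumberField L] [IsCMField L]
    {v : HeightOneSpectrum (𝓞 ↥(maximalRealSubfield L))} (w : UnitaryGroup.PlacesOver L v)
    (hw : IsCMField.complexConj L • w.1 = w.1) (he : v.asIdeal.ramificationIdx' w.1.asIdeal ≠ 1)
    (ϖ : w.1.adicCompletion L) (hϖ : Valued.v ϖ = WithZero.exp (-1 : ℤ))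
    [MeasurableSpace ((cmDatum L 2 (Matrix.of fun i j : Fin 2 => if i.val + j.val + 1 = 2 then (1 : L) else 0)).Local v ×
      (cmDatum L 1 (Matrix.of fun i j : Fin 1 => if i.val + j.val + 1 = 1 then (1 : L) else 0)).Local v)]
    [BorelSpace ((cmDatum L 2 (Matrix.of fun i j : Fin 2 => if i.val + j.val + 1 = 2 then (1 : L) else 0)).Local v ×
      (cmDatum L 1 (Matrix.of fun i j : Fin 1 => if i.val + j.val + 1 = 1 then (1 : L) else 0)).Local v)]
    (νH : Measure ((cmDatum L 2 (Matrix.of fun i j : Fin 2 => if i.val + j.val + 1 = 2 then (1 : L) else 0)).Local v ×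
      (cmDatum L 1 (Matrix.of fun i j : Fin 1 => if i.val + j.val + 1 = 1 then (1 : L) else 0)).Local v)) [νH.IsHaarMeasure]
    (d : ℕ) (cA cB : ℂ) :
    (fun s : Fin 2 => if ((s : Fin 2) : ℕ) = d % 2 then (cA + cB) / (2 * (νH.real (Function.support (hFamily L w hw ϖ s)) : ℂ)) else -cB / (2 * (νH.real (Function.support (hFamily L w hw ϖ s)) : ℂ))) 0 *
        (νH.real (Function.support (hFamily L w hw ϖ 0)) : ℂ) +
      (fun s : Fin 2 => if ((s : Fin 2) : ℕ) = d % 2 then (cA + cB) / (2 * (νH.real (Function.support (hFamily L w hw ϖ s)) : ℂ)) else -cB / (2 * (νH.real (Function.support (hFamily L w hw ϖ s)) : ℂ))) 1 *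
        (νH.real (Function.support (hFamily L w hw ϖ 1)) : ℂ) = cA / 2 := by
  have h0 : (νH.real (Function.support (hFamily L w hw ϖ 0)) : ℂ) ≠ 0 := measureReal_support_hFamily_ne_zero L w hw he ϖ hϖ νH 0
  have h1 : (νH.real (Function.support (hFamily L w hw ϖ 1)) : ℂ) ≠ 0 := measureReal_support_hFamily_ne_zero L w hw he ϖ hϖ νH 1
  rcases Nat.mod_two_eq_zero_or_one d with hd | hd
  · simp only [hd, Fin.isValue, Fin.val_zero, Fin.val_one, Nat.one_ne_zero, if_true, if_false]
    field_simp
    ring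
  · simp only [hd, Fin.isValue, Fin.val_zero, Fin.val_one, Nat.zero_ne_one, if_true, if_false]
    field_simp
    ring

/-- **`hnum` shape**: if `cA = 2·R` then `coefAffine 0·ν_0 + coefAffine 1·ν_1 = R` — instantiate `R := ρ_piece · ((νG₃.real K : ℂ) ∕ (νH.real K_H : ℂ) · ν_0)` to get the
row-(3) hypothesis of ★ (V5-lev) `rowThree_levels_hFamily_of_scalar` ∕ ★ p859539 verbatim.  [cite: Rogawski1990, §4.9 Lemma 4.9.2 p. 56] -/
theorem coefAffine_rowThree_number_eq_of_eq
    (L : Type) [Field L] [NumberField L] [IsCMField L]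
    {v : HeightOneSpectrum (𝓞 ↥(maximalRealSubfield L))} (w : UnitaryGroup.PlacesOver L v)
    (hw : IsCMField.complexConj L • w.1 = w.1) (he : v.asIdeal.ramificationIdx' w.1.asIdeal ≠ 1)
    (ϖ : w.1.adicCompletion L) (hϖ : Valued.v ϖ = WithZero.exp (-1 : ℤ))
    [MeasurableSpace ((cmDatum L 2 (Matrix.of fun i j : Fin 2 => if i.val + j.val + 1 = 2 then (1 : L) else 0)).Local v ×
      (cmDatum L 1 (Matrix.of fun i j : Fin 1 => if i.val + j.val + 1 = 1 then (1 : L) else 0)).Local v)]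
    [BorelSpace ((cmDatum L 2 (Matrix.of fun i j : Fin 2 => if i.val + j.val + 1 = 2 then (1 : L) else 0)).Local v ×
      (cmDatum L 1 (Matrix.of fun i j : Fin 1 => if i.val + j.val + 1 = 1 then (1 : L) else 0)).Local v)]
    (νH : Measure ((cmDatum L 2 (Matrix.of fun i j : Fin 2 => if i.val + j.val + 1 = 2 then (1 : L) else 0)).Local v ×
      (cmDatum L 1 (Matrix.of fun i j : Fin 1 => if i.val + j.val + 1 = 1 then (1 : L) else 0)).Local v)) [νH.IsHaarMeasure]
    (d : ℕ) (cA cB R : ℂ) (hcA : cA = 2 * R) :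
    (fun s : Fin 2 => if ((s : Fin 2) : ℕ) = d % 2 then (cA + cB) / (2 * (νH.real (Function.support (hFamily L w hw ϖ s)) : ℂ)) else -cB / (2 * (νH.real (Function.support (hFamily L w hw ϖ s)) : ℂ))) 0 *
        (νH.real (Function.support (hFamily L w hw ϖ 0)) : ℂ) +
      (fun s : Fin 2 => if ((s : Fin 2) : ℕ) = d % 2 then (cA + cB) / (2 * (νH.real (Function.support (hFamily L w hw ϖ s)) : ℂ)) else -cB / (2 * (νH.real (Function.support (hFamily L w hw ϖ s)) : ℂ))) 1 *
        (νH.real (Function.support (hFamily L w hw ϖ 1)) : ℂ) = R := by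
  rw [coefAffine_rowThree_number_eq L w hw he ϖ hϖ νH d cA cB, hcA]
  ring

end Summit.HodgeConjecture.HodgeConjecture.Cruxes.H413.F0P3cDyRamCoefAffineRowThreeNumber

end
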